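import Summits.BirchSwinnertonDyer.Rank1Residual.AdditivePotMult.QuadraticBaseChangeOddTamagawaAdditiveOddPrime
import Summits.BirchSwinnertonDyer.Rank1Residual.AdditivePotMult.QuadraticBaseChangeDescentReal
import HarnessLib

/-!
# The base-change-and-descend END at EVERY ODD `p` (`p = 3` included) with additive places prime
# to `d_K` allowed, CONDITIONAL on the unramified-base-change fact A233
# (row T-MIL-3, FILE H-2 — the `p = 3` twin of FILE G-1; seat n1011-p01 GEN 8)

HONEST FRAMING (cell `b2b-bsdres`, run/shared/lean/b2b/bsd-rank1-residual/, verbatim in every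
file): the goal of the cell is to DELETE the COMBINATION-SHAPED residual classes of the
Birch–Swinnerton-Dyer formula for ALL analytic-rank `≤ 1` elliptic curves over `ℚ` — "full BSD
formula for every rank `≤ 1` curve in class `C`" assembled STRICTLY from published theorems — so
that the rank-`≤ 1` remainder becomes exactly the CONSTRUCTION-SHAPED classes, which are TYPED
(missing-input `Prop`s), NOT attempted. This is not "finishing BSD". Sub-classes X3♯(M) / X4(M)
(additive, potentially multiplicative prime; base-change-and-descend): a RESEARCH ROUTE; they stay
CONSTRUCTION-SHAPED; nothing is booked by this file; no mark / label moved. THEOREMS ONLY: no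
definition, no named fact, no `sorry`.

## What (sequel of rows T-MIL-SHA / T-MIL-R1 / T-MIL-REAL / T-MIL-S3)

FILE G-1 (`QuadraticBaseChangeDescentUnramifiedFact`) gives the END on S₃ —
`BSDp W p ⟸ MissingPPartOverAt W' p ∧ BSDp Wd p`, additive places prime to `d_K` allowed,
CONDITIONAL on A233 — for `p ≥ 5` only, because its odd Tamagawa identity (FILE C-3h) kills additive
Tamagawa numbers by `c ≤ 4 < p`. FILE H-1 (`QuadraticBaseChangeOddTamagawaAdditiveOddPrime`) proves that
identity at EVERY odd `p` (`padicValRat_norm_mul_tamagawaProduct_eq_of_unramifiedFact_odd`), the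
price of `p = 3` being ONE census-decidable proviso inside the additive disjunct of the local
hypothesis: `p = 3 → ℓ_v ≠ 3 ∧ (ℓ_v = 2 → d_K % 8 = 1 ∨ (W.kodairaSymbolAt v ≠ IV ∧ W.kodairaSymbolAt v ≠ IV*))`
(at an additive `2`: `2` split in `K`, or Kodaira type not `IV`/`IV*`).
This file is G-1 with `5 ≤ p` replaced by `p ≠ 2` and that proviso:

* `milneQuotient_ordp_of_unramifiedFact_imaginary_odd` / `…_real_odd` — `hWR_p` at every odd `p`,
  total rank `≤ 1`, GIVEN `hA`;
* `bsdp_of_pPartOver_of_bsdp_twist_quadratic_of_unramifiedFact_odd` — **the END at every odd `p`,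
  either signature: `BSDp W p ⟸ MissingPPartOverAt W' p ∧ BSDp Wd p` for `[K:ℚ] = 2` with `d_K`
  odd squarefree, `W.analyticRank + Wd.analyticRank ≤ 1`, `W` good ∨ multiplicative ∨ (`ℓ ∣ d_K` ∧
  `Wd` multiplicative) ∨ (additive with `ℓ ∤ d_K` and the `p = 3` proviso) at every place —
  hypotheses `hGZK`, `hmod` and the A233 instance family `hA` (CONDITIONAL on A233; A65 NOT used).**
  At `p = 3` — THE prime of the additive block N10/N11, `K = ℚ(√−3)` or any `K` ramified at `3` —
  this is the first A65-free descent END admitting additive places away from `d_K`.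

HONEST LIMITS: CONDITIONAL on A233 (a named fact, not discharged here; row T-A233 of n1011-p16);
NOT covered at `p = 3`: additive places over `2` of Kodaira type `IV`/`IV*` when `2` is inert in `K`
(the `ℓ = 2` unit-twist FLIP — located gap), additive `W` at an unramified `3` (never in-class);
`d_K` odd squarefree; total analytic rank `≤ 1`; X3♯(M)/X4(M) stay CONSTRUCTION-SHAPED; TOOL/END
theorems; closes no class; moves no mark; G-1 stays as the dominated `p ≥ 5` twin.

References: J. S. Milne, Invent. Math. 17 (1972) §1 Thm. 1, §2 [Milne1972ArithmeticAV];
J. H. Silverman, *AEC* 2nd ed., Prop. VII.5.4 (a) [SilvermanAEC2009]; *ATAEC* IV.9.4, Table 4.1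
[SilvermanATAEC1994]; T. Dokchitser, V. Dokchitser, Ann. of Math. 172 (2010) §2.1
[DokchitserDokchitserAnnals2010]; R. L. Miller, LMS J. Comput. Math. 14 (2011) Def. 1.1
[Miller2011LMS].
-/

noncomputable section

open scoped Classical NumberField

open WeierstrassCurve NumberField NumberField.InfinitePlace IsDedekindDomain Rat.HeightOneSpectrum
  Literature.NumberTheory.EllipticCurves Literature.NumberTheory.EllipticCurves.Rank1Residual
  Literature.NumberTheory.EllipticCurves.Rank1Residual.Typed
  Literature.NumberTheory.DiophantineGeometry

namespace Summit.BirchSwinnertonDyer.Rank1Residual.AdditivePotMult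

section UnramifiedFactOdd

variable (W : WeierstrassCurve ℚ) [W.IsElliptic] [W.IsGloballyMinimal] (p : ℕ) [hp : Fact p.Prime]
  (K : Type) [Field K] [NumberField K]
  (Wd : WeierstrassCurve ℚ) [Wd.IsElliptic] [Wd.IsGloballyMinimal]
  (W' : WeierstrassCurve K) [W'.IsElliptic] [W'.IsGloballyMinimal]

/-- **`hWR_p` at every odd `p`, IMAGINARY `K`, total rank `≤ 1`, CONDITIONAL on A233 (`hA`)**:
FILE E-2's schema with `n = n_W` (tree `realPeriod_mul_realPeriod_quadraticTwist_eq_mul_bsdPeriod`),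
`m ∈ {1,2,4}` (FILE E-1) and FILE H-1's END `padicValRat_norm_mul_tamagawaProduct_eq_of_unramifiedFact_odd`
(local hypothesis with the `p = 3` proviso). G-1's `…_imaginary` with `5 ≤ p` ↦ `p ≠ 2`.
[cite: Milne1972ArithmeticAV, §1 Thm. 1 and §2 (through DokchitserDokchitserAnnals2010, §2.1, proof of Thm. 8)]
[cite: SilvermanAEC2009, Prop. VII.5.4 (a)] [cite: SilvermanATAEC1994, IV.9.4 and Table 4.1] -/
theorem milneQuotient_ordp_of_unramifiedFact_imaginary_odd [IsTotallyComplex K]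
    (h2 : Module.finrank ℚ K = 2)
    (hdodd : Odd (NumberField.discr K)) (hdsq : Squarefree (NumberField.discr K))
    {Cd : VariableChange ℚ} (hWd : Cd • W.quadraticTwist (NumberField.discr K : ℚ) = Wd)
    {C' : VariableChange K} (hW' : C' • W.baseChange K = W') [Finite W.sha] [Finite Wd.sha]
    (hr : W.mordellWeilRank + Wd.mordellWeilRank ≤ 1)
    (hA : ∀ (v : HeightOneSpectrum (𝓞 ℚ)) (w : HeightOneSpectrum (𝓞 K)),
      kodairaSymbolAt_baseChange_of_ramificationIdx_eq_one K v w W)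
    (hp2 : p ≠ 2)
    (hS : ∀ v : HeightOneSpectrum (𝓞 ℚ), W.HasGoodReductionAt v ∨ W.HasMultiplicativeReductionAt v ∨
      (((primesEquiv v : ℕ) : ℤ) ∣ NumberField.discr K ∧ Wd.HasMultiplicativeReductionAt v) ∨
      (W.HasAdditiveReductionAt v ∧ ¬ ((primesEquiv v : ℕ) : ℤ) ∣ NumberField.discr K ∧
        (p = 3 → (primesEquiv v : ℕ) ≠ 3 ∧ ((primesEquiv v : ℕ) = 2 → NumberField.discr K % 8 = 1 ∨
          (W.kodairaSymbolAt v ≠ .IV ∧ W.kodairaSymbolAt v ≠ .IVstar))))) :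
    ∃ q : ℚ, 0 < q ∧ padicValRat p q = 0 ∧
      (W'.shaOrder : ℝ) * W'.regulator * W'.bsdPeriod * (W'.tamagawaProduct : ℝ) /
          (W'.torsionOrder : ℝ) ^ 2 = (q : ℝ) * (W.bsdRHS * Wd.bsdRHS) := by
  obtain ⟨m, hm124, hm⟩ := exists_mul_regulator_baseChange_quadratic_of_rank_add_le_one W K h2 Wd
    ⟨Cd, hWd⟩ W' ⟨C', hW'⟩ hr
  have hm0 : m ≠ 0 := by rcases hm124 with rfl | rfl | rfl <;> norm_num
  have hn0 : (W.baseChange ℝ).numRealComponents ≠ 0 := (W.baseChange ℝ).numRealComponents_pos.ne'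
  haveI : Fact (Nat.Prime 2) := ⟨Nat.prime_two⟩
  have h2v : padicValRat p (2 : ℚ) = 0 := by
    rw [show (2 : ℚ) = ((2 : ℕ) : ℚ) by norm_num, padicValRat.of_nat, padicValNat_primes hp2,
      Nat.cast_zero]
  have hnv : padicValRat p ((W.baseChange ℝ).numRealComponents : ℚ) = 0 := by
    rw [numRealComponents_baseChange_real]
    split_ifs
    · rw [padicValRat.of_nat, padicValNat_primes hp2, Nat.cast_zero]
    · rw [Nat.cast_one, padicValRat.one]
  have hmv : padicValRat p (m : ℚ) = 0 := by
    rcases hm124 with rfl | rfl | rfl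
    · rw [Nat.cast_one, padicValRat.one]
    · exact_mod_cast h2v
    · rw [show ((4 : ℕ) : ℚ) = (2 : ℚ) ^ 2 by norm_num, padicValRat.pow, h2v, mul_zero]
  exact milneQuotient_ordp_of_tamagawa_of_arch_of_regulator W K Wd W' h2 hWd hW' hn0 hm0
    (realPeriod_mul_realPeriod_quadraticTwist_eq_mul_bsdPeriod W K h2) hm p hp2 hnv hmv
    (padicValRat_norm_mul_tamagawaProduct_eq_of_unramifiedFact_odd W K Wd W' h2 hdodd hdsq hWd hW' hA
      p hp2 hS)

/-- **`hWR_p` at every odd `p`, REAL `K` (`hreal`), total rank `≤ 1`, CONDITIONAL on A233 (`hA`)**: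
as above with `n = 1` (FILE F-1). G-1's `…_real` with `5 ≤ p` ↦ `p ≠ 2`.
[cite: Milne1972ArithmeticAV, §1 Thm. 1 and §2 (through DokchitserDokchitserAnnals2010, §2.1, proof of Thm. 8)]
[cite: SilvermanAEC2009, Prop. VII.5.4 (a)] [cite: SilvermanATAEC1994, IV.9.4 and Table 4.1] -/
theorem milneQuotient_ordp_of_unramifiedFact_real_odd (h2 : Module.finrank ℚ K = 2)
    (hreal : IsTotallyReal K)
    (hdodd : Odd (NumberField.discr K)) (hdsq : Squarefree (NumberField.discr K))
    {Cd : VariableChange ℚ} (hWd : Cd • W.quadraticTwist (NumberField.discr K : ℚ) = Wd)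
    {C' : VariableChange K} (hW' : C' • W.baseChange K = W') [Finite W.sha] [Finite Wd.sha]
    (hr : W.mordellWeilRank + Wd.mordellWeilRank ≤ 1)
    (hA : ∀ (v : HeightOneSpectrum (𝓞 ℚ)) (w : HeightOneSpectrum (𝓞 K)),
      kodairaSymbolAt_baseChange_of_ramificationIdx_eq_one K v w W)
    (hp2 : p ≠ 2)
    (hS : ∀ v : HeightOneSpectrum (𝓞 ℚ), W.HasGoodReductionAt v ∨ W.HasMultiplicativeReductionAt v ∨
      (((primesEquiv v : ℕ) : ℤ) ∣ NumberField.discr K ∧ Wd.HasMultiplicativeReductionAt v) ∨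
      (W.HasAdditiveReductionAt v ∧ ¬ ((primesEquiv v : ℕ) : ℤ) ∣ NumberField.discr K ∧
        (p = 3 → (primesEquiv v : ℕ) ≠ 3 ∧ ((primesEquiv v : ℕ) = 2 → NumberField.discr K % 8 = 1 ∨
          (W.kodairaSymbolAt v ≠ .IV ∧ W.kodairaSymbolAt v ≠ .IVstar))))) :
    ∃ q : ℚ, 0 < q ∧ padicValRat p q = 0 ∧
      (W'.shaOrder : ℝ) * W'.regulator * W'.bsdPeriod * (W'.tamagawaProduct : ℝ) /
          (W'.torsionOrder : ℝ) ^ 2 = (q : ℝ) * (W.bsdRHS * Wd.bsdRHS) :=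
  milneQuotient_ordp_of_tamagawa_real W p K Wd W' h2 hreal hWd hW' hr hp2
    (padicValRat_norm_mul_tamagawaProduct_eq_of_unramifiedFact_odd W K Wd W' h2 hdodd hdsq hWd hW' hA
      p hp2 hS)

/-- **THE BASE-CHANGE-AND-DESCEND END AT EVERY ODD `p` (`p = 3` INCLUDED), EITHER SIGNATURE,
CONDITIONAL ON A233 (not on A65).** `W/ℚ`, `Wd = C_d • W^{(d_K)}`, `W' = C' • W_K` globally
minimal; `[K:ℚ] = 2` with `d_K` odd squarefree; `r_an(W) + r_an(Wd) ≤ 1`; `p` odd; at every place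
`W` is good ∨ multiplicative ∨ (`ℓ ∣ d_K` ∧ `Wd` multiplicative) ∨ (ADDITIVE with `ℓ ∤ d_K` and
the `p = 3` proviso `p = 3 → ℓ ≠ 3 ∧ (ℓ = 2 → d_K % 8 = 1 ∨ W.kodairaSymbolAt v ≠ IV, IV*)`); `hA` = the named
fact A233 `kodairaSymbolAt_baseChange_of_ramificationIdx_eq_one` at every `(v, w)`. THEN
**`BSDp W p ⟸ MissingPPartOverAt W' p ∧ BSDp Wd p`** (other hypotheses: `hGZK`, `hmod`). G-1's END
with `5 ≤ p` ↦ `p ≠ 2`; at `p ≥ 5` the proviso is vacuous. So at `p = 3` too the descent on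
S₂/S₃ trades Milne's A65 for A233. NOT CLAIMED: at `p = 3`, additive places over `2` of type
`IV`/`IV*` with `2` inert in `K` (row T-MIL-B2's entry) and additive `W` at an unramified `3`; even
`d_K`; `p = 2`; total analytic rank `≥ 2`; A233 itself (hypothesis `hA`, W only).
[cite: Milne1972ArithmeticAV, §1 Thm. 1 and §2 (through DokchitserDokchitserAnnals2010, §2.1, proof of Thm. 8)]
[cite: SilvermanAEC2009, Prop. VII.5.4 (a)] [cite: SilvermanATAEC1994, IV.9.4 and Table 4.1]
[cite: Miller2011LMS, Def. 1.1 (arXiv:1010.2431 p. 3)] -/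
theorem bsdp_of_pPartOver_of_bsdp_twist_quadratic_of_unramifiedFact_odd
    (hGZK : rank_eq_analyticRank_of_analyticRank_le_one) (hmod : hasEntireLFunction_rat)
    (h2 : Module.finrank ℚ K = 2)
    (hdodd : Odd (NumberField.discr K)) (hdsq : Squarefree (NumberField.discr K))
    {Cd : VariableChange ℚ} (hWd : Cd • W.quadraticTwist (NumberField.discr K : ℚ) = Wd)
    {C' : VariableChange K} (hW' : C' • W.baseChange K = W')
    (hr : W.analyticRank + Wd.analyticRank ≤ 1)
    (hA : ∀ (v : HeightOneSpectrum (𝓞 ℚ)) (w : HeightOneSpectrum (𝓞 K)),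
      kodairaSymbolAt_baseChange_of_ramificationIdx_eq_one K v w W)
    (hp2 : p ≠ 2)
    (hS : ∀ v : HeightOneSpectrum (𝓞 ℚ), W.HasGoodReductionAt v ∨ W.HasMultiplicativeReductionAt v ∨
      (((primesEquiv v : ℕ) : ℤ) ∣ NumberField.discr K ∧ Wd.HasMultiplicativeReductionAt v) ∨
      (W.HasAdditiveReductionAt v ∧ ¬ ((primesEquiv v : ℕ) : ℤ) ∣ NumberField.discr K ∧
        (p = 3 → (primesEquiv v : ℕ) ≠ 3 ∧ ((primesEquiv v : ℕ) = 2 → NumberField.discr K % 8 = 1 ∨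
          (W.kodairaSymbolAt v ≠ .IV ∧ W.kodairaSymbolAt v ≠ .IVstar)))))
    (hK : MissingPPartOverAt W' p) (hd : BSDp Wd p) : BSDp W p := by
  have hr1 : W.analyticRank ≤ 1 := by omega
  have hrd1 : Wd.analyticRank ≤ 1 := by omega
  obtain ⟨hrankW, hfinW⟩ := hGZK W hr1
  obtain ⟨hrankD, hfinD⟩ := hGZK Wd hrd1
  haveI : Finite W.sha := hfinW
  haveI : Finite Wd.sha := hfinD
  have hrMW : W.mordellWeilRank + Wd.mordellWeilRank ≤ 1 := by rw [hrankW, hrankD]; exact hr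
  rcases isTotallyReal_or_isTotallyComplex_of_finrank_eq_two K h2 with hR | hC
  · exact bsdp_of_pPartOver_of_bsdp_twist_ordp W p K Wd W' hGZK hmod hr1 h2 ⟨Cd, hWd⟩ hrd1 ⟨C', hW'⟩
      (milneQuotient_ordp_of_unramifiedFact_real_odd W p K Wd W' h2 hR hdodd hdsq hWd hW' hrMW hA hp2
        hS) hK hd
  · haveI := hC
    exact bsdp_of_pPartOver_of_bsdp_twist_ordp W p K Wd W' hGZK hmod hr1 h2 ⟨Cd, hWd⟩ hrd1 ⟨C', hW'⟩
      (milneQuotient_ordp_of_unramifiedFact_imaginary_odd W p K Wd W' h2 hdodd hdsq hWd hW' hrMW hA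
        hp2 hS) hK hd

/-- **The in-class form: `K` RAMIFIED at `p` (`p ∣ d_K` — e.g. the canonical `K = ℚ(√p*)` of the
X3♯(M)/X4(M) descent at `p`, `ℚ(√−3)` at `p = 3`).** Then the clause `ℓ ≠ 3` of the `p = 3` proviso
is automatic (an additive place with `ℓ ∤ d_K` is not over `p`), and the local hypothesis reads: `W`
good ∨ multiplicative ∨ (`ℓ ∣ d_K` ∧ `Wd` multiplicative) ∨ (additive ∧ `ℓ ∤ d_K` ∧
(`p = 3 → ℓ = 2 → d_K % 8 = 1 ∨ W.kodairaSymbolAt v ≠ IV, IV*`)). Same conclusion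
`BSDp W p ⟸ MissingPPartOverAt W' p ∧ BSDp Wd p`, CONDITIONAL on A233 (`hA`).
[cite: Milne1972ArithmeticAV, §1 Thm. 1 and §2 (through DokchitserDokchitserAnnals2010, §2.1, proof of Thm. 8)]
[cite: SilvermanAEC2009, Prop. VII.5.4 (a)] [cite: SilvermanATAEC1994, IV.9.4 and Table 4.1] -/
theorem bsdp_of_pPartOver_of_bsdp_twist_quadratic_of_unramifiedFact_odd_of_dvd_discr
    (hGZK : rank_eq_analyticRank_of_analyticRank_le_one) (hmod : hasEntireLFunction_rat)
    (h2 : Module.finrank ℚ K = 2)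
    (hdodd : Odd (NumberField.discr K)) (hdsq : Squarefree (NumberField.discr K))
    (hpd : (p : ℤ) ∣ NumberField.discr K)
    {Cd : VariableChange ℚ} (hWd : Cd • W.quadraticTwist (NumberField.discr K : ℚ) = Wd)
    {C' : VariableChange K} (hW' : C' • W.baseChange K = W')
    (hr : W.analyticRank + Wd.analyticRank ≤ 1)
    (hA : ∀ (v : HeightOneSpectrum (𝓞 ℚ)) (w : HeightOneSpectrum (𝓞 K)),
      kodairaSymbolAt_baseChange_of_ramificationIdx_eq_one K v w W)
    (hp2 : p ≠ 2)
    (hS : ∀ v : HeightOneSpectrum (𝓞 ℚ), W.HasGoodReductionAt v ∨ W.HasMultiplicativeReductionAt v ∨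
      (((primesEquiv v : ℕ) : ℤ) ∣ NumberField.discr K ∧ Wd.HasMultiplicativeReductionAt v) ∨
      (W.HasAdditiveReductionAt v ∧ ¬ ((primesEquiv v : ℕ) : ℤ) ∣ NumberField.discr K ∧
        (p = 3 → (primesEquiv v : ℕ) = 2 → NumberField.discr K % 8 = 1 ∨
          (W.kodairaSymbolAt v ≠ .IV ∧ W.kodairaSymbolAt v ≠ .IVstar))))
    (hK : MissingPPartOverAt W' p) (hd : BSDp Wd p) : BSDp W p := by
  refine bsdp_of_pPartOver_of_bsdp_twist_quadratic_of_unramifiedFact_odd W p K Wd W' hGZK hmod h2 hdodd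
    hdsq hWd hW' hr hA hp2 (fun v => ?_) hK hd
  rcases hS v with h | h | h | ⟨hadd, hnd, hprov⟩
  · exact Or.inl h
  · exact Or.inr (Or.inl h)
  · exact Or.inr (Or.inr (Or.inl h))
  · refine Or.inr (Or.inr (Or.inr ⟨hadd, hnd, fun hp3 => ⟨fun hv3 => hnd ?_, hprov hp3⟩⟩))
    rw [hv3, ← hp3]
    exact hpd

end UnramifiedFactOdd

end Summit.BirchSwinnertonDyer.Rank1Residual.AdditivePotMult

end
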